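/-
Copyright (c) 2026 the pub-hodgecm2 formalisation cell (harness21).  New file, outside the frozen port manifest.
Origin: seat `prover-pub-hodgecm2-d2bridge-prove-2-g1-0` (Δ2 BRIDGE team; VERSION-B item (c) J-RECORD PIN; ASSEMBLER DECISION #8 = the fixed
pin signatures `PIN-SIGNATURES.assembler.lean`), 2026-08-23.  Two definitions + four theorems; no named fact, no `sorry`; HC_CM is NOT proved.
-/
import Summits.HodgeConjecture.CorCM.D2Bridge.Map43RecordAtPinLevels
import Literature.NumberTheory.Automorphic.Liu2021.AppendixC.Prop413DataOfRestOne
import HarnessLib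

set_option autoImplicit false

/-!
# Δ2 bridge, the S2 PIN (part 3): the record at the rests of record `U.rest (restTailOne …)`

The J-pin binder `M i hμ hg` of the assembler's FIXED SIGNATURES (`PinSignatures.thm418C_ofTower_of_pins`, DECISION #8) has type
`(toThm418Data C (U.rest (tail i hμ hg))).Map43RationalData` for μ-UNIFORM theta-side carriers `U : UniformOmega C` ([Liu2021] Def. 4.11, so
that Prop. 4.13 is cited literally) and the one-object tail `tail := restTailOne emb ιg hμ hw Car (T.rhoΩOne …)` (RULING (R-unif)).  Since
`U.rest (restTailOne … rhoΩ) = restOne C … U.Eps U.epsOf U.Chi (U.omega μ hμ) (U.rho μ hμ) rhoΩ` by `rfl` (`UniformOmega.restOne_eq_rest`) and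
`T.restOne … = restOne C … (T.rhoΩOne …)` by `rfl`, the record `map43RecordAtPin` (part 1) at `U`'s carriers inhabits that type ON THE NOSE;
this file performs the (definitional, but not instant: ≈ 3·10⁵ heartbeats of structure-type unification) re-typing ONCE, so that the
composition writes `M i hμ hg := map43RecordAtUniformRest J … U Dμ τ' hτ'` with nothing to unfold.  HC_CM is NOT proved; «Δ2 BRIDGE CLOSED»
is NOT claimed.

## References
* [Liu2021] Y. Liu, *Fourier–Jacobi cycles and arithmetic relative trace formula*, Camb. J. Math. 9 (2021) = arXiv:2102.11518 — Def. 4.11,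
  Def. 4.16, proof of Thm. 4.18 (FJcycle.tex l. 2247–2253).
* Tree: `CorCM/D2Bridge/Map43RecordAtPinLevels.lean` (part 1), `Liu2021/AppendixC/Prop413DataOfRestOne.lean` (`restTailOne`, `restOne_eq_rest`).
-/

noncomputable section

open Literature.AlgebraicGeometry.HodgeTheory
open Literature.AlgebraicGeometry.ShimuraVarieties.UnitaryCanonicalModel (exists_recordSystem)
open Literature.NumberTheory.Automorphic Literature.NumberTheory.Automorphic.Liu2021 Literature.NumberTheory.Automorphic.Liu2021.AppendixC
open Literature.NumberTheory.Automorphic.Liu2021.AppendixC.RestOne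
open Literature.NumberTheory.Automorphic.PicardCM
open Literature.NumberTheory.Transcendental (Arapura2012_Cor_15_4_6)
open HodgeCM.Model.TowerCarrier
open Summit.HodgeConjecture.CorCM.D2Bridge.TowerRational

namespace Summit.HodgeConjecture.CorCM.D2Bridge

variable {hHD : exists_isReal_hodgeModel} {hI : hodgePQ_independent_of_hodgeModel}
  {hU : BallQuotientUniformisedDatum} {h₃ : CMAbelianVarietyRealised} {hA : Arapura2012_Cor_15_4_6}
variable {L : HodgeCM.CMField} {ι₁ : L →+* ℂ} {V : HodgeCM.HermSpace3 L ι₁} {h : exists_recordSystem}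
  {Φ : Literature.AlgebraicGeometry.Motives.CMType L} {isotropicAt : ℕ → Prop}
  {C : Sec42Data (Model.honestP5Of h ⟨L.K⟩ ι₁ ⟨V.Hm, V.isHermitian, V.signature_ι₁, V.posDef_of_ne⟩ Φ) isotropicAt}
  {T : C.HeckeTranslates} [Algebra L ℂ]
  (J : ComponentAlbanese hHD hI hU h₃ hA V h Φ C T)
  {Lg : Type} [Field Lg] [NumberField Lg] [IsGalois ℚ Lg] (emb : L →ₐ[ℚ] Lg) (ιg : Lg →+* ℂ)
  {μ : Literature.NumberTheory.Automorphic.IdeleClassGroup L →ₜ* Circle}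
  (hμ : Literature.NumberTheory.Automorphic.IdeleClassGroup.IsConjugateSymplectic L μ)
  (hw : Literature.NumberTheory.Automorphic.IdeleClassGroup.HasWeight L μ 1) (Car : Def45.Carriers L μ)
  (U : UniformOmega C)

set_option maxHeartbeats 1600000 in
-- (definitional re-typing of one large structure type, `toThm418Data C (T.restOne …)` vs `toThm418Data C (U.rest (restTailOne …))`; no search)
/-- **THE RECORD AT THE RESTS OF RECORD `U.rest (restTailOne …)`** — the (c) binder `M i hμ hg` of `PinSignatures.thm418C_ofTower_of_pins`
at μ-uniform carriers `U` and the one-object tail: `map43RecordAtPin` (part 1) at `Eps := U.Eps`, …, `rho := U.rho μ hμ`, re-typed along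
`U.rest (restTailOne …) = T.restOne …` (`rfl`, `UniformOmega.restOne_eq_rest`). [cite: Liu2021, proof of Thm. 4.18 (FJcycle.tex l. 2247–2253); Def. 4.11; Def. 4.16] -/
def map43RecordAtUniformRest (Dμ : ObjOne emb ιg hμ hw Car) (τ' : L →+* ℂ) (hτ' : τ' ∈ hμ.cmType.1) :
    (toThm418Data C (U.rest (restTailOne emb ιg hμ hw Car (T.rhoΩOne emb ιg hμ hw Car)))).Map43RationalData :=
  (map43RecordAtPin J emb ιg hμ hw Car U.Eps U.epsOf U.Chi (U.omega μ hμ) (U.rho μ hμ) Dμ τ' hτ' :)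

/-- The re-typed record's complex carrier is the tower (`rfl`): `jH := LinearMap.id`. [cite: Liu2021, §4.2 (FJcycle.tex l. 2076–2081)] -/
theorem map43RecordAtUniformRest_HB (Dμ : ObjOne emb ιg hμ hw Car) (τ' : L →+* ℂ) (hτ' : τ' ∈ hμ.cmType.1) :
    (map43RecordAtUniformRest J emb ιg hμ hw Car U Dμ τ' hτ').HB = Tower hHD hI hU h₃ hA V :=
  rfl

/-- The S₀ binder `hjH` for the re-typed record: `ρB g x = of g • x` on the tower (J1 `towerRep_eq_of_smul`).
[cite: Liu2021, §4.2 (FJcycle.tex l. 2074–2081)] -/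
theorem map43RecordAtUniformRest_ρB_apply (Dμ : ObjOne emb ιg hμ hw Car) (τ' : L →+* ℂ) (hτ' : τ' ∈ hμ.cmType.1)
    (g : ↥V.adelicFin) (x : Tower hHD hI hU h₃ hA V) :
    (map43RecordAtUniformRest J emb ιg hμ hw Car U Dμ τ' hτ').ρB g x = MonoidAlgebra.of ℂ ↥V.adelicFin g • x :=
  towerRep_eq_of_smul hHD hI hU h₃ hA g x

/-- **The S₀ binder `jH` for the re-typed record**: its complex carrier is the tower, read by the identity (a DECLARED reading, so that
`HcmPieces … H jH …` elaborates with the tower's canonical instances). [cite: Liu2021, §4.2 (FJcycle.tex l. 2076–2081)] -/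
def jHUniformRest (Dμ : ObjOne emb ιg hμ hw Car) (τ' : L →+* ℂ) (hτ' : τ' ∈ hμ.cmType.1) :
    (map43RecordAtUniformRest J emb ιg hμ hw Car U Dμ τ' hτ').HB →ₗ[ℂ] Tower hHD hI hU h₃ hA V :=
  LinearMap.id

/-- `jHUniformRest = id` is injective (the S₀ binder `hjHinj`). [folklore] -/
theorem jHUniformRest_injective (Dμ : ObjOne emb ιg hμ hw Car) (τ' : L →+* ℂ) (hτ' : τ' ∈ hμ.cmType.1) :
    Function.Injective (jHUniformRest J emb ιg hμ hw Car U Dμ τ' hτ') :=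
  fun _ _ e => e

/-- The S₀ binder `hjH` through `jHUniformRest`: `jH (ρB g x) = of g • jH x` (J1 `towerRep_eq_of_smul`). [cite: Liu2021, §4.2 (FJcycle.tex l. 2074–2081)] -/
theorem jHUniformRest_comm (Dμ : ObjOne emb ιg hμ hw Car) (τ' : L →+* ℂ) (hτ' : τ' ∈ hμ.cmType.1)
    (g : ↥V.adelicFin) (x : (map43RecordAtUniformRest J emb ιg hμ hw Car U Dμ τ' hτ').HB) :
    jHUniformRest J emb ιg hμ hw Car U Dμ τ' hτ' ((map43RecordAtUniformRest J emb ιg hμ hw Car U Dμ τ' hτ').ρB g x) =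
      MonoidAlgebra.of ℂ ↥V.adelicFin g • jHUniformRest J emb ιg hμ hw Car U Dμ τ' hτ' x :=
  towerRep_eq_of_smul hHD hI hU h₃ hA g x

end Summit.HodgeConjecture.CorCM.D2Bridge

end
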